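import Summits.AnomalousDissipation.AnomalousDissipation.Theorems.SawtoothPulseCascadeK1LocalisedCascadeFibreData
import Summits.AnomalousDissipation.AnomalousDissipation.Theorems.SawtoothPulseCascadeK1LocalisedCascadeFibreFactor

/-!
# K1loc, line `Spectral` / SeqCone — helper: THE PER-FIBRE SOCKET OF THE LEDGER FROM PROFILE DATA (S-B assembly, step 5)

Helper file of the prover lane on the crux `K1LocalisedCascade` (stmt-AnomalousDissipation-19491), route
`SawtoothPulseCascade` (closes the generic S-B assembly chain `…FibreFactor` → `…OneFamily` → `…MultiplierBundle` →
`…FibreData`).  `fibre_estimate_of_profile_data` produces the abstract per-fibre un-gauging estimate `hfib` of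
`…K1Slot.sqrt_tsum_symbol_sq_family_step_H/_V` (equivalently `hfib_p`/`hfib_m` of `…K1Ledger.ledger_step_H/_V[_of_moduli]`)
for the TRUE profile `R = P + Q` on EVERY fibre, from fibrewise PROFILE DATA with fibre-UNIFORM constants:
* the flat-strip data of the cut-off `X` against the exact-flat profile `P` (`P′ = s` on `U`, `X =ᶠ 0` off `U`,
  `|X^{(k)}| ≤ D_k`), per-fibre branch shifts `b_n` with `|b_n − n s| ≤ β₀` (for the cascade `b_n = round(nσγ)`, `β₀ = ½`);
* an envelope radius `R₀` beyond which the old symbol is `≡ 1` on the fibre;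
* below `R₀`: `C^r` fibre profiles `Mμ_n` of the old symbol and `N_n` of the squared shifted new symbol (through a fibre
  version `m_n` of `m`) with fibre-uniform derivative bounds `Cμ_α`, `CN_α` (`α ≤ r`), the branch compatibility, and a
  fibre-uniform leakage constant `A_Q` of the residual shear `Φ_Q`.
Constants: `A = A⋆(β₀) + A_Q`, `C = C⋆(β₀)` with
`A⋆ = Σ_{1≤α<r} B_α(β₀)·Cμ_α/(α!(2π)^α) + (Cμ_r/r!)·B_{r+2}(β₀)/(12(2π)^r)`, `C⋆ = (CN_r/r!)·B_{r+2}(β₀)/(12(2π)^r)`,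
`B_α(β) = Σ_{i≤α} C(α,i)(2πβ)ⁱ D_{α−i}` (monotone in `β`, `bundleBound_mono`); `leak_of_twist_moments` supplies the residual
leakage hypothesis from the twist spectral moments (`…SpectralLeakage.sqrt_tsum_symbol_sq_comp_shearMap_fibre_le`).
No definitions; no statement about the stub.
[cite: Grafakos2014, Prop. 3.1.2 (5) and Prop. 3.2.7 (3)] [problem: turb]
-/

-- `Summit.<Summit>.<Problem>`: single-conjunct summit, the duplicate namespace segment is deliberate.
set_option linter.dupNamespace false

noncomputable section

namespace Summit.AnomalousDissipation.AnomalousDissipation.Theorems.SawtoothPulseCascade.K1Ledger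

open MeasureTheory Set Filter Topology UnitAddTorus Complex
open scoped ComplexConjugate ContDiff Nat
open Literature.Analysis Literature.Analysis.FunctionSpaces Literature.Analysis.FunctionSpaces.Torus
open Summit.AnomalousDissipation.AnomalousDissipation.Theorems.SawtoothPulseCascade.SpectralLeakage
open Summit.AnomalousDissipation.AnomalousDissipation.Theorems.SawtoothPulseCascade.K1Slot

/-! ## §1 Monotonicity of the constants -/

/-- The bundle bound `B_α(β) = Σ_{i≤α} C(α,i)(2πβ)ⁱ D_{α−i}` is monotone in `β ≥ 0` when `D ≥ 0`. [folklore] -/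
theorem bundleBound_mono {D : ℕ → ℝ} (hD0 : ∀ k, 0 ≤ D k) {β β₀ : ℝ} (hβ : 0 ≤ β) (hle : β ≤ β₀) (α : ℕ) :
    ∑ i ∈ Finset.range (α + 1), (α.choose i : ℝ) * (2 * Real.pi * β) ^ i * D (α - i) ≤
      ∑ i ∈ Finset.range (α + 1), (α.choose i : ℝ) * (2 * Real.pi * β₀) ^ i * D (α - i) := by
  refine Finset.sum_le_sum fun i _ => ?_
  have h1 : (2 * Real.pi * β) ^ i ≤ (2 * Real.pi * β₀) ^ i :=
    pow_le_pow_left₀ (by positivity) (by nlinarith [Real.pi_pos]) i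
  exact mul_le_mul_of_nonneg_right (mul_le_mul_of_nonneg_left h1 (by positivity)) (hD0 _)

/-- Monotonicity of the per-fibre estimate in its constants: `(S + AW)² + 2CI ≤ (S + A'W)² + 2C'I` for
`0 ≤ S, W, I`, `0 ≤ A ≤ A'`, `C ≤ C'`. [folklore] -/
theorem estimate_mono {T S W I A A' C C' : ℝ} (hS : 0 ≤ S) (hW : 0 ≤ W) (hI : 0 ≤ I) (hA : 0 ≤ A) (hAA : A ≤ A')
    (hCC : C ≤ C') (h : T ≤ (S + A * W) ^ 2 + 2 * C * I) : T ≤ (S + A' * W) ^ 2 + 2 * C' * I := by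
  have h1 : (S + A * W) ^ 2 ≤ (S + A' * W) ^ 2 :=
    pow_le_pow_left₀ (by positivity) (by nlinarith) 2
  nlinarith

/-! ## §2 The socket -/

/-- **The per-fibre estimate for the true profile from profile data** (`hfib` of the tracked-family steps).  See the module
docstring for the data; the conclusion is, for every fibre `k_i = n` and every smooth `G` on it,
`Σ' m²|𝓕((X(x_j)+Z(x_j))·G(Φ_R x))|² ≤ (√Σ' μ²|𝓕G|² + (A⋆(β₀) + A_Q)‖G‖)² + 2C⋆(β₀)‖G‖²`.
[cite: Grafakos2014, Prop. 3.1.2 (5) and Prop. 3.2.7 (3)] -/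
theorem fibre_estimate_of_profile_data {i j : Fin 2} (hij : i ≠ j) (P Q R : ShearProfile) (hR : ∀ y, R y = P y + Q y)
    (X Z : ShearProfile) (hX1 : ∀ y, |X y| ≤ 1) (hZ : ∀ y, Z y = 0)
    {U : Set ℝ} {s : ℝ} (hPU : ∀ y ∈ U, HasDerivAt P s y) (hXU : ∀ y, y ∉ U → (fun y : ℝ => (X y : ℂ)) =ᶠ[𝓝 y] 0)
    {D : ℕ → ℝ} (hD : ∀ k y, |iteratedDeriv k X y| ≤ D k) {r : ℕ} (hr : 1 ≤ r)
    {m μ : (Fin 2 → ℤ) → ℝ} (hm1 : ∀ k, |m k| ≤ 1) (R₀ : ℝ)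
    (hone : ∀ n : ℤ, R₀ ≤ |(n : ℝ)| → ∀ k : Fin 2 → ℤ, k i = n → μ k = 1)
    (b : ℤ → ℤ) {β₀ : ℝ} (hβ0 : 0 ≤ β₀) (hβ : ∀ n : ℤ, |(n : ℝ)| < R₀ → |((b n : ℤ) : ℝ) - n * s| ≤ β₀)
    (Mμ : ℤ → ℝ → ℝ) (hMμc : ∀ n : ℤ, |(n : ℝ)| < R₀ → ContDiff ℝ r (Mμ n))
    (hμM : ∀ n : ℤ, |(n : ℝ)| < R₀ → ∀ k : Fin 2 → ℤ, k i = n → μ k = Mμ n (k j))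
    {Cμ : ℕ → ℝ} (hCμ0 : ∀ α, 0 ≤ Cμ α)
    (hCμ : ∀ n : ℤ, |(n : ℝ)| < R₀ → ∀ α ≤ r, ∀ t, |iteratedDeriv α (Mμ n) t| ≤ Cμ α)
    (mf : ℤ → (Fin 2 → ℤ) → ℝ) (hmf : ∀ (n : ℤ) (k : Fin 2 → ℤ), k i = n → mf n k = m k)
    (hmf1 : ∀ n k, |mf n k| ≤ 1)
    (N : ℤ → ℝ → ℝ) (hNc : ∀ n : ℤ, |(n : ℝ)| < R₀ → ContDiff ℝ r (N n))
    (hmN : ∀ n : ℤ, |(n : ℝ)| < R₀ → ∀ k : Fin 2 → ℤ, mf n (k - Pi.single j (b n)) ^ 2 = N n (k j))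
    {CN : ℕ → ℝ} (hCN0 : ∀ α, 0 ≤ CN α)
    (hCN : ∀ n : ℤ, |(n : ℝ)| < R₀ → ∀ α ≤ r, ∀ t, |iteratedDeriv α (N n) t| ≤ CN α)
    (hcomp : ∀ n : ℤ, |(n : ℝ)| < R₀ → ∀ k : Fin 2 → ℤ, k i = n → m (k - Pi.single j (b n)) ^ 2 ≤ μ k ^ 2)
    {AQ : ℝ} (hAQ : 0 ≤ AQ)
    (hleak : ∀ n : ℤ, |(n : ℝ)| < R₀ → ∀ G : UnitAddTorus (Fin 2) → ℂ, IsSmooth G →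
      (∀ k, mFourierCoeff G k ≠ 0 → k i = n) →
      Real.sqrt (∑' k, μ k ^ 2 * ‖mFourierCoeff (G ∘ shearMap i j Q) k‖ ^ 2) ≤
        Real.sqrt (∑' k, μ k ^ 2 * ‖mFourierCoeff G k‖ ^ 2) + AQ * Real.sqrt (∫ x, ‖G x‖ ^ 2))
    (n : ℤ) (G : UnitAddTorus (Fin 2) → ℂ) (hG : IsSmooth G) (hn : ∀ k, mFourierCoeff G k ≠ 0 → k i = n) :
    ∑' k, m k ^ 2 * ‖mFourierCoeff (fun x => ((X.onCircle (x j) : ℂ) + Z.onCircle (x j)) * G (shearMap i j R x)) k‖ ^ 2 ≤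
      (Real.sqrt (∑' k, μ k ^ 2 * ‖mFourierCoeff G k‖ ^ 2) +
          ((∑ α ∈ Finset.Ico 1 r, (∑ i ∈ Finset.range (α + 1), (α.choose i : ℝ) * (2 * Real.pi * β₀) ^ i * D (α - i)) *
              (Cμ α / ((α ! : ℝ) * (2 * Real.pi) ^ α)) +
            Cμ r / (r ! : ℝ) * ((∑ i ∈ Finset.range (r + 2 + 1), ((r + 2).choose i : ℝ) * (2 * Real.pi * β₀) ^ i *
              D (r + 2 - i)) / (12 * (2 * Real.pi) ^ r))) + AQ) * Real.sqrt (∫ x, ‖G x‖ ^ 2)) ^ 2 +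
        2 * (CN r / (r ! : ℝ) * ((∑ i ∈ Finset.range (r + 2 + 1), ((r + 2).choose i : ℝ) * (2 * Real.pi * β₀) ^ i *
            D (r + 2 - i)) / (12 * (2 * Real.pi) ^ r))) * ∫ x, ‖G x‖ ^ 2 := by
  -- sign bookkeeping
  have hD0 : ∀ k, 0 ≤ D k := fun k => (abs_nonneg _).trans (hD k 0)
  set Bβ : ℕ → ℝ := fun α => ∑ i ∈ Finset.range (α + 1), (α.choose i : ℝ) * (2 * Real.pi * β₀) ^ i * D (α - i) with hBβ
  set Astar : ℝ := ∑ α ∈ Finset.Ico 1 r, Bβ α * (Cμ α / ((α ! : ℝ) * (2 * Real.pi) ^ α)) +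
    Cμ r / (r ! : ℝ) * (Bβ (r + 2) / (12 * (2 * Real.pi) ^ r)) with hAstar
  set Cstar : ℝ := CN r / (r ! : ℝ) * (Bβ (r + 2) / (12 * (2 * Real.pi) ^ r)) with hCstar
  -- the cut-off as a torus function
  have hΞc : Continuous fun x : UnitAddTorus (Fin 2) => (X.onCircle (x j) : ℂ) + Z.onCircle (x j) :=
    (continuous_ofReal.comp (isSmooth_onCircle_comp' X j).continuous).add
      (continuous_ofReal.comp (isSmooth_onCircle_comp' Z j).continuous)
  have hΞ1 : ∀ x : UnitAddTorus (Fin 2), ‖(X.onCircle (x j) : ℂ) + Z.onCircle (x j)‖ ≤ 1 := fun x => by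
    obtain ⟨y, hy⟩ := QuotientAddGroup.mk_surjective (x j)
    rw [← hy, ShearProfile.onCircle_coe, ShearProfile.onCircle_coe, hZ, Complex.ofReal_zero, add_zero, Complex.norm_real,
      Real.norm_eq_abs]
    exact hX1 y
  have hBβ0 : ∀ α, 0 ≤ Bβ α := fun α => Finset.sum_nonneg fun i _ => by
    have := hD0 (α - i); have := hβ0; positivity
  have hA0 : 0 ≤ Astar := by
    refine add_nonneg (Finset.sum_nonneg fun α _ => mul_nonneg (hBβ0 α) (div_nonneg (hCμ0 α) (by positivity))) ?_
    exact mul_nonneg (div_nonneg (hCμ0 r) (by positivity)) (div_nonneg (hBβ0 _) (by positivity))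
  have hC0 : 0 ≤ Cstar := mul_nonneg (div_nonneg (hCN0 r) (by positivity)) (div_nonneg (hBβ0 _) (by positivity))
  -- the two cases
  rcases le_or_gt R₀ |(n : ℝ)| with hR₀ | hR₀
  · -- beyond the envelope: the old symbol is `≡ 1` on the fibre
    have h := fibre_estimate_of_symbol_eq_one hij R hΞc hΞ1 hm1 (hone n hR₀) (add_nonneg hA0 hAQ) hC0 hG hn
    simpa only [hAstar, hCstar, hBβ] using h
  · -- below the envelope: factorise the shear and use the profile data of the fibre
    have hb0 : 0 ≤ |((b n : ℤ) : ℝ) - n * s| := abs_nonneg _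
    have hfibP : ∀ G' : UnitAddTorus (Fin 2) → ℂ, IsSmooth G' → (∀ k, mFourierCoeff G' k ≠ 0 → k i = n) →
        ∑' k, m k ^ 2 * ‖mFourierCoeff (fun x => ((X.onCircle (x j) : ℂ) + Z.onCircle (x j)) *
            G' (shearMap i j P x)) k‖ ^ 2 ≤
          (Real.sqrt (∑' k, μ k ^ 2 * ‖mFourierCoeff G' k‖ ^ 2) + Astar * Real.sqrt (∫ x, ‖G' x‖ ^ 2)) ^ 2 +
            2 * Cstar * ∫ x, ‖G' x‖ ^ 2 := by
      intro G' hG' hn'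
      have h := fibre_estimate_one_family_of_fibre_data hG' hij hn' P X Z hX1 hZ (b n) hPU hXU hD hr (hMμc n hR₀)
        (hμM n hR₀) (hCμ n hR₀) (hmf n) (hmf1 n) (hNc n hR₀) (hmN n hR₀) (hCN n hR₀) (hcomp n hR₀)
      -- monotonicity in the shift defect `|b_n − n s| ≤ β₀`
      have hmono : ∀ α, ∑ i ∈ Finset.range (α + 1), (α.choose i : ℝ) * (2 * Real.pi * |((b n : ℤ) : ℝ) - n * s|) ^ i *
          D (α - i) ≤ Bβ α := fun α => bundleBound_mono hD0 hb0 (hβ n hR₀) α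
      have hAle : ∑ α ∈ Finset.Ico 1 r, (∑ i ∈ Finset.range (α + 1), (α.choose i : ℝ) *
            (2 * Real.pi * |((b n : ℤ) : ℝ) - n * s|) ^ i * D (α - i)) * (Cμ α / ((α ! : ℝ) * (2 * Real.pi) ^ α)) +
          Cμ r / (r ! : ℝ) * ((∑ i ∈ Finset.range (r + 2 + 1), ((r + 2).choose i : ℝ) *
            (2 * Real.pi * |((b n : ℤ) : ℝ) - n * s|) ^ i * D (r + 2 - i)) / (12 * (2 * Real.pi) ^ r)) ≤ Astar := by
        rw [hAstar]
        refine add_le_add (Finset.sum_le_sum fun α _ => mul_le_mul_of_nonneg_right (hmono α)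
          (div_nonneg (hCμ0 α) (by positivity))) ?_
        exact mul_le_mul_of_nonneg_left (div_le_div_of_nonneg_right (hmono (r + 2)) (by positivity))
          (div_nonneg (hCμ0 r) (by positivity))
      have hCle : CN r / (r ! : ℝ) * ((∑ i ∈ Finset.range (r + 2 + 1), ((r + 2).choose i : ℝ) *
            (2 * Real.pi * |((b n : ℤ) : ℝ) - n * s|) ^ i * D (r + 2 - i)) / (12 * (2 * Real.pi) ^ r)) ≤ Cstar := by
        rw [hCstar]
        exact mul_le_mul_of_nonneg_left (div_le_div_of_nonneg_right (hmono (r + 2)) (by positivity))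
          (div_nonneg (hCN0 r) (by positivity))
      have hAn0 : 0 ≤ ∑ α ∈ Finset.Ico 1 r, (∑ i ∈ Finset.range (α + 1), (α.choose i : ℝ) *
            (2 * Real.pi * |((b n : ℤ) : ℝ) - n * s|) ^ i * D (α - i)) * (Cμ α / ((α ! : ℝ) * (2 * Real.pi) ^ α)) +
          Cμ r / (r ! : ℝ) * ((∑ i ∈ Finset.range (r + 2 + 1), ((r + 2).choose i : ℝ) *
            (2 * Real.pi * |((b n : ℤ) : ℝ) - n * s|) ^ i * D (r + 2 - i)) / (12 * (2 * Real.pi) ^ r)) := by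
        refine add_nonneg (Finset.sum_nonneg fun α _ => mul_nonneg (Finset.sum_nonneg fun i _ => ?_)
          (div_nonneg (hCμ0 α) (by positivity))) (mul_nonneg (div_nonneg (hCμ0 r) (by positivity))
          (div_nonneg (Finset.sum_nonneg fun i _ => ?_) (by positivity)))
        · have := hD0 (α - i); positivity
        · have := hD0 (r + 2 - i); positivity
      exact estimate_mono (Real.sqrt_nonneg _) (Real.sqrt_nonneg _) (integral_nonneg fun x => by positivity) hAn0 hAle
        hCle h
    have h := fibre_estimate_of_factor hij P Q R hR (fun x => (X.onCircle (x j) : ℂ) + Z.onCircle (x j)) hA0 hfibP hG hn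
      (hleak n hR₀ G hG hn)
    simpa only [hAstar, hCstar, hBβ] using h

/-! ## §3 The residual leakage from twist spectral moments -/

/-- **The residual-shear leakage hypothesis from first-order data.**  If `ω` is a (global) modulus of the old symbol `μ`
(`|μ(k) − μ(k−q)| ≤ ω(q)`, `ω ≥ 0`, `|μ| ≤ M_μ`) and, on every fibre `|n| < R₀`, the spectrum of the residual twist
`x ↦ twist Q n (x_j)` is summable with `Σ_q ω(q)‖𝓕(twist Q n ∘ x_j)(q)‖ ≤ A_Q`, then the hypothesis `hleak` of
`fibre_estimate_of_profile_data` holds with that `A_Q` (`…SpectralLeakage.sqrt_tsum_symbol_sq_comp_shearMap_fibre_le`).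
[cite: Grafakos2014, Prop. 3.1.2 (5) and Prop. 3.2.7 (3)] -/
theorem leak_of_twist_moments {i j : Fin 2} (Q : ShearProfile) {μ : (Fin 2 → ℤ) → ℝ} {Mμ : ℝ} (hμM : ∀ k, |μ k| ≤ Mμ)
    {wd : (Fin 2 → ℤ) → ℝ} (hω0 : ∀ q, 0 ≤ wd q) (hω : ∀ k q, |μ k - μ (k - q)| ≤ wd q) (R₀ : ℝ) {AQ : ℝ}
    (hΘs : ∀ n : ℤ, |(n : ℝ)| < R₀ →
      Summable fun q => ‖mFourierCoeff (fun x : UnitAddTorus (Fin 2) => twist Q n (x j)) q‖)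
    (hωs : ∀ n : ℤ, |(n : ℝ)| < R₀ →
      Summable fun q => wd q * ‖mFourierCoeff (fun x : UnitAddTorus (Fin 2) => twist Q n (x j)) q‖)
    (hAQ : ∀ n : ℤ, |(n : ℝ)| < R₀ →
      ∑' q, wd q * ‖mFourierCoeff (fun x : UnitAddTorus (Fin 2) => twist Q n (x j)) q‖ ≤ AQ) :
    ∀ n : ℤ, |(n : ℝ)| < R₀ → ∀ G : UnitAddTorus (Fin 2) → ℂ, IsSmooth G →
      (∀ k, mFourierCoeff G k ≠ 0 → k i = n) →
      Real.sqrt (∑' k, μ k ^ 2 * ‖mFourierCoeff (G ∘ shearMap i j Q) k‖ ^ 2) ≤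
        Real.sqrt (∑' k, μ k ^ 2 * ‖mFourierCoeff G k‖ ^ 2) + AQ * Real.sqrt (∫ x, ‖G x‖ ^ 2) := by
  intro n hn G hG hGn
  have h := sqrt_tsum_symbol_sq_comp_shearMap_fibre_le hG hGn Q j hμM hω0 hω (hΘs n hn) (hωs n hn)
  exact h.trans (add_le_add le_rfl (mul_le_mul_of_nonneg_right (hAQ n hn) (Real.sqrt_nonneg _)))

end Summit.AnomalousDissipation.AnomalousDissipation.Theorems.SawtoothPulseCascade.K1Ledger
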